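import Summits.QuantumFields.YangMills.Theorems.BalabanUVNodesN15KingModelCurvedHTorus
import Summits.QuantumFields.YangMills.Theorems.BalabanUVNodesN15KingModelPerturbedNE2

/-!
# Route «BalabanUVNodes» (K4 «SpineRates»), node N15 = NE2 — THE KING-MODEL RUNG, part 8a: THE PERTURBATION GENERATED BY A FINE-LATTICE
# POTENTIAL — the FIRST VARIATION `E(w) = N^{−(d+1)} Σ_x ℋ(x,·) w(x) ℋ(x,·)` of King's effective Laplacian along a potential `w`, the block ∕ fibre
# bookkeeping of the two spacings, and its LOCALITY and TWO-SPACING entry bounds from the minimiser's decay and two-spacing step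

Cell `pub-ymgap`, Track A (D-0062), seat `pub-ymgap-dag-n15-d` (R134 seat, strategy s3 «King 1986 Lemma 4.5 (4.38) as the scalar kernel», gen 6;
dag-lead FAN-OUT v1.2 §N15 s3 «KING-MODEL RUNG»).  `bears_on: R4∕N15`; `--supports` the K3′ item `SpineGivenEndpointR12` (stmt-QuantumFields-19908).
COUNT-NEUTRAL; definition lane (two objects `potLevel`, `potTower`, one parametrisation `overOff` and the volume abbreviations `kingM`∕`kingU` of §4
are data; every theorem is kernel bookkeeping).

WHY THIS FILE.  Parts 6a–7c dress King's `A = 0` tower `Δ^{(k)}` by an ABSTRACT local perturbation tower `E` and READ the (3.35)∕(3.36) slots of the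
background sort as the two letters the socket needs of `E` — locality `|E_k(z,w)| ≤ c_E e^{−2κ|z−w|}` and two-spacing `|E_{k+1} − E_k| ≤ ε_E r^k` —
«asserted by nobody» (every HONEST SCOPE since 6a).  Parts 8a–8c DERIVE both letters for the one concrete perturbation King's construction offers:
a scalar POTENTIAL `w` on the fine torus `T_η` enters the block-spin energy (King's (2.13)–(2.14), tree `King1986.Torus.energy`) as
`N^{−(d+1)}⟨ψ, wψ⟩`, and the FIRST VARIATION of the effective quadratic form `⟨φ, Δ^{(k)}φ⟩ = min_ψ energy` along `w` is, by the envelope formula at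
the minimiser `ψ_φ = ℋ_kφ` (tree `effLaplacian_eq_energy`), the unit-lattice operator `E(w)(b,b′) = N^{−(d+1)} Σ_{x ∈ T_η} ℋ_k(x,b)·w(x)·ℋ_k(x,b′)`
(`potLevel`; ℋ_k = King's minimiser kernel, n15-e's `kingH` = `King1986.Torus.minimiser` at `δ_b`, BY NAME).  THIS FILE (generic in the decay data):
§1 sums over the fine torus `Π ℤ∕(N·U_μ)` by unit blocks (`sum_fine_eq_sum_blocks`, `abs_avg_sum_le_sum_blocks`: `|N^{−(d+1)}Σ_x F| ≤ Σ_z G(z)` when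
`|F(x)| ≤ G(B(x))`), and THE FIBRES OF THE POINT UNDER between the runs with `L^k` and `L·L^k` fine points per unit side (`overOff (x,i) = L·x + i`,
`underPtN_overOff`, `overOff_bijective`, **`sum_comp_underPtN`**: `Σ_{x′} F(x under x′) = L^{d+1} Σ_x F(x)`, **`avg_comp_underPtN`**: the two runs'
block averages of a pulled-back function AGREE) — the pairing behind King's *«x′ ∈ B^n(x)»*; §2 the objects `potLevel`, `potTower` (the ℕ-tower at
`N = L^{max j 1}`, constant below level 1 as the lineage's `kingTower`), `potLevel_congr` (transport along `L^{j+1} = L·L^j`), `potTower_succ_sub`;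
§3 the two ENTRY BOUNDS from factor bounds: **`potLevel_entry_le`** — `|ℋ| ≤ c e^{−δ|B−b|}`, `|w| ≤ w₀` ⇒ `|E(w)(b,b′)| ≤ w₀c²K_{d+1}(δ∕2)e^{−(δ∕2)|b−b′|}`
(LOCAL, linear in the potential; `sum_exp_two_centre_le` = triangle inequality + `tdistT_sumBound`), and **`potLevel_sub_entry_le`** — with King's
Prop. 3.8 step `|ℋ′(x′,b) − ℋ(x,b)| ≤ Ct·e^{−δ|B−b|}` and the potentials' COHERENCE DEFECT `|w′(x′) − w(x)| ≤ ν` (`x` under `x′`):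
`|E′(w′) − E(w)|(b,b′) ≤ (2w₀cCt + c²ν)·K·e^{−(δ∕2)|b−b′|}` (three-factor telescoping at every fine point of the finer run, paired by §1).
Part 8b fires §3 on King's tori with `minimiser_row_decay` ∕ `king_prop38_torus_blocks` BY NAME (the letters as THEOREMS); part 8c fires part 6a's
socket: `NE2PlusUnit` BY NAME for a background sort of potential towers whose (3.35)∕(3.36) slots are SIZE and COHERENCE of the potential.

HONEST FRAMING ∕ LIMITS.  King's `A = 0` SCALAR block-spin construction (periodic b.c., flat blocks, `m² > 0`); the perturbation is the FIRST-ORDER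
term only (the dressed operator `Δ^{(k)}_{tw} = Δ^{(k)} + tE(w) + O(t²)` and the envelope identity are NOT constructed here — `potLevel` is a
DEFINITION, standard first-order perturbation theory of a quadratic minimum); a scalar potential is NOT a gauge field: nothing here is Bałaban's
`Δ^{(k)}(U) − Δ^{(k)}(1)`, `C^{(k)}(Λ; U)`, `G(U)`, whose η-differences are NOT PRINTED ([B9] prints η-uniformity and analyticity in `U`, Thm 3.4);
NOT the carriers of record (NODE 00); NOT a node discharge; typed 28∕28, discharged count untouched; one finite torus programme at fixed ε — NOT ℝ⁴ ∕
infinite volume ∕ OS ∕ mass gap ∕ Clay.  Locators only: [King1986] = C. King, CMP **102** (1986) 649–677: (2.13)–(2.15) p. 653 (energy, minimiser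
`ℋ_k = a_kG_kQ_k^*`), Theorem 3.3 (3.7) p. 658 (decay of ℋ_k), p. 664 (*«When x′ ∈ T_{η′}, we denote by x that point in T_η for which x′ ∈ B^n(x)»*),
Prop. 3.8 (3.71) p. 664, (4.41) p. 675 (summation); [B9] = [Balaban1985BackgroundPropagators] CMP **99** (1985) (3.35)–(3.36) p. 396, Thm 3.4 p. 400.
-/

noncomputable section

open scoped BigOperators
open Finset

namespace Summit.QuantumFields.YangMills.BalabanUVNodes.N15.KingModel

open Literature.MathematicalPhysics.QuantumFieldTheory.Balaban1983to89 hiding blockOf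
open Literature.MathematicalPhysics.QuantumFieldTheory.Balaban1983to89.B4Sect5Proof (latticeConst latticeConst_nonneg)
open Literature.MathematicalPhysics.QuantumFieldTheory.Balaban1983to89.B5Prop11Plancherel (Tor fine)
open Literature.MathematicalPhysics.QuantumFieldTheory.King1986.Torus (minimiser blockEquiv blockEquiv_apply site blockOf blockOf_site
  tdistT tdistT_isPseudoDist tdistT_sumBound)
open Summit.QuantumFields.YangMills.BalabanUVNodes.N15KingModelRung (kingH)
open Summit.QuantumFields.YangMills.BalabanUVNodes.N15KingModelRung.Curved (underPtN val_underPtN blockOf_underPtN)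

variable {d : ℕ}

/-! ## §1 Sums over King's fine torus: block decomposition, and the fibres of the point UNDER -/

section Blocks

variable (N : ℕ) [NeZero N] (U : Fin (d + 1) → ℕ) [∀ μ, NeZero (U μ)]

/-- A sum over the fine torus `Π ℤ∕(N·U_μ)` is the sum over the unit blocks `z` of the sums over the `N^{d+1}` offsets `site N U z j`
(`King1986.Torus.blockEquiv`). [folklore] -/
theorem sum_fine_eq_sum_blocks (F : Tor (fine N U) → ℝ) :
    ∑ x, F x = ∑ z : Tor U, ∑ j : Fin (d + 1) → Fin N, F (site N U z j) := by
  rw [← (blockEquiv N U).sum_comp F, Fintype.sum_prod_type]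
  rfl

omit [NeZero N] in
/-- The number of offsets in a block: `|[0,N)^{d+1}| = N^{d+1}` (as a real number). [folklore] -/
theorem card_offsets : (Fintype.card (Fin (d + 1) → Fin N) : ℝ) = ((N : ℕ) : ℝ) ^ (d + 1) := by
  rw [Fintype.card_fun, Fintype.card_fin, Fintype.card_fin]
  push_cast
  rfl

/-- **BLOCKWISE DOMINATION OF A BLOCK-AVERAGED SUM**: if `|F(x)| ≤ G(B(x))` at every fine point, then
`|N^{−(d+1)} Σ_x F(x)| ≤ Σ_z G(z)` (each block has `N^{d+1}` points). [folklore] -/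
theorem abs_avg_sum_le_sum_blocks {F : Tor (fine N U) → ℝ} {G : Tor U → ℝ} (h : ∀ x, |F x| ≤ G (blockOf N U x)) :
    |(((N : ℕ) : ℝ) ^ (d + 1))⁻¹ * ∑ x, F x| ≤ ∑ z, G z := by
  have hN : (0 : ℝ) < ((N : ℕ) : ℝ) ^ (d + 1) := pow_pos (Nat.cast_pos.mpr (Nat.pos_of_ne_zero (NeZero.ne N))) _
  rw [abs_mul, abs_inv, abs_of_pos hN, inv_mul_le_iff₀ hN]
  calc |∑ x, F x| ≤ ∑ x, |F x| := abs_sum_le_sum_abs _ _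
    _ ≤ ∑ x, G (blockOf N U x) := sum_le_sum fun x _ => h x
    _ = ∑ z : Tor U, ∑ j : Fin (d + 1) → Fin N, G (blockOf N U (site N U z j)) := sum_fine_eq_sum_blocks N U _
    _ = ∑ z : Tor U, ((N : ℕ) : ℝ) ^ (d + 1) * G z := by
        refine sum_congr rfl fun z _ => ?_
        rw [sum_congr rfl fun j _ => by rw [blockOf_site], sum_const, card_univ, nsmul_eq_mul, card_offsets N]
    _ = ((N : ℕ) : ℝ) ^ (d + 1) * ∑ z, G z := by rw [mul_sum]

end Blocks

section Over

variable (L : ℕ) [NeZero L] (U : Fin (d + 1) → ℕ) [∀ μ, NeZero (U μ)]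

/-- THE POINTS OVER `x`: for `x` in the torus with `L^k` fine points per unit side and an offset `i ∈ [0,L)^{d+1}`, the point `L·x + i` of the torus
with `L·L^k` fine points per unit side (King's *«x′ ∈ B^n(x)»* at `n = 1`, parametrised). [cite: King1986, p.664 (convention before Prop. 3.8)] -/
def overOff (k : ℕ) (x : Tor (fine (L ^ k) U)) (i : Fin (d + 1) → Fin L) : Tor (fine (L ^ 1 * L ^ k) U) :=
  fun μ => ((L * (x μ).val + (i μ : ℕ) : ℕ) : ZMod (fine (L ^ 1 * L ^ k) U μ))

/-- Its coordinates: `(L·x + i)_μ = L·x_μ + i_μ` (no wrap-around). [folklore] -/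
theorem val_overOff (k : ℕ) (x : Tor (fine (L ^ k) U)) (i : Fin (d + 1) → Fin L) (μ : Fin (d + 1)) :
    (overOff L U k x i μ).val = L * (x μ).val + (i μ : ℕ) := by
  have hx : (x μ).val < L ^ k * U μ := ZMod.val_lt (x μ)
  have hi : (i μ : ℕ) < L := (i μ).isLt
  have hlt : L * (x μ).val + (i μ : ℕ) < L ^ 1 * L ^ k * U μ := by
    calc L * (x μ).val + (i μ : ℕ) < L * (x μ).val + L := by omega
      _ = L * ((x μ).val + 1) := by ring
      _ ≤ L * (L ^ k * U μ) := Nat.mul_le_mul_left _ hx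
      _ = L ^ 1 * L ^ k * U μ := by ring
  show (((L * (x μ).val + (i μ : ℕ) : ℕ)) : ZMod (L ^ 1 * L ^ k * U μ)).val = _
  rw [ZMod.val_natCast, Nat.mod_eq_of_lt hlt]

/-- `L·x + i` lies over `x`: `underPtN (overOff x i) = x`. [cite: King1986, p.664 (convention before Prop. 3.8)] -/
theorem underPtN_overOff (k : ℕ) (x : Tor (fine (L ^ k) U)) (i : Fin (d + 1) → Fin L) :
    underPtN L k 1 U (overOff L U k x i) = x := by
  have hL : 0 < L := Nat.pos_of_ne_zero (NeZero.ne L)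
  funext μ
  apply ZMod.val_injective
  rw [val_underPtN, val_overOff, pow_one, Nat.mul_add_div hL, Nat.div_eq_of_lt (i μ).isLt, add_zero]

/-- `(x, i) ↦ L·x + i` is injective. [folklore] -/
theorem overOff_injective (k : ℕ) :
    Function.Injective (fun p : Tor (fine (L ^ k) U) × (Fin (d + 1) → Fin L) => overOff L U k p.1 p.2) := by
  rintro ⟨x, i⟩ ⟨x', i'⟩ h
  have hL : 0 < L := Nat.pos_of_ne_zero (NeZero.ne L)
  have hμ : ∀ μ, x μ = x' μ ∧ i μ = i' μ := by
    intro μ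
    have hv : (overOff L U k x i μ).val = (overOff L U k x' i' μ).val := congrArg ZMod.val (congr_fun h μ)
    rw [val_overOff, val_overOff] at hv
    have hi : (i μ : ℕ) < L := (i μ).isLt
    have hi' : (i' μ : ℕ) < L := (i' μ).isLt
    have h1 : (x μ).val = (x' μ).val := by
      have h2 := congrArg (· / L) hv
      simp only [Nat.mul_add_div hL, Nat.div_eq_of_lt hi, Nat.div_eq_of_lt hi', add_zero] at h2
      exact h2
    refine ⟨ZMod.val_injective _ h1, Fin.ext ?_⟩
    rw [h1] at hv
    omega
  exact Prod.ext (funext fun μ => (hμ μ).1) (funext fun μ => (hμ μ).2)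

/-- `|T_{L^k}| · L^{d+1} = |T_{L·L^k}|`. [folklore] -/
theorem card_over (k : ℕ) :
    Fintype.card (Tor (fine (L ^ k) U) × (Fin (d + 1) → Fin L)) = Fintype.card (Tor (fine (L ^ 1 * L ^ k) U)) := by
  rw [Fintype.card_prod, Fintype.card_fun, Fintype.card_fin, Fintype.card_fin]
  simp only [Tor, fine, Fintype.card_pi, ZMod.card, Finset.prod_mul_distrib, Finset.prod_const, Finset.card_univ,
    Fintype.card_fin]
  ring

/-- `(x, i) ↦ L·x + i` is a bijection `T_{L^k} × [0,L)^{d+1} → T_{L·L^k}`. [folklore] -/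
theorem overOff_bijective (k : ℕ) :
    Function.Bijective (fun p : Tor (fine (L ^ k) U) × (Fin (d + 1) → Fin L) => overOff L U k p.1 p.2) :=
  (Fintype.bijective_iff_injective_and_card _).mpr ⟨overOff_injective L U k, card_over L U k⟩

/-- **THE FIBRE IDENTITY**: summing a function of the point UNDER over the finer torus counts every point of the coarser torus `L^{d+1}` times.
[folklore] -/
theorem sum_comp_underPtN (k : ℕ) (F : Tor (fine (L ^ k) U) → ℝ) :
    ∑ x' : Tor (fine (L ^ 1 * L ^ k) U), F (underPtN L k 1 U x') = (L : ℝ) ^ (d + 1) * ∑ x, F x := by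
  rw [← (overOff_bijective L U k).sum_comp (fun x' => F (underPtN L k 1 U x'))]
  simp only [underPtN_overOff]
  rw [Fintype.sum_prod_type]
  simp only [sum_const, card_univ, Fintype.card_fun, Fintype.card_fin, nsmul_eq_mul, mul_sum]
  push_cast
  rfl

/-- **BLOCK AVERAGES OF A PULLED-BACK FUNCTION AGREE AT THE TWO SPACINGS**:
`(L·L^k)^{−(d+1)} Σ_{x′} F(x under x′) = (L^k)^{−(d+1)} Σ_x F(x)`. [folklore] -/
theorem avg_comp_underPtN (k : ℕ) (F : Tor (fine (L ^ k) U) → ℝ) :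
    (((L ^ 1 * L ^ k : ℕ) : ℝ) ^ (d + 1))⁻¹ * ∑ x' : Tor (fine (L ^ 1 * L ^ k) U), F (underPtN L k 1 U x')
      = (((L ^ k : ℕ) : ℝ) ^ (d + 1))⁻¹ * ∑ x, F x := by
  have hL : (L : ℝ) ≠ 0 := Nat.cast_ne_zero.mpr (NeZero.ne L)
  have hLk : (L : ℝ) ^ k ≠ 0 := pow_ne_zero _ hL
  rw [sum_comp_underPtN]
  push_cast
  field_simp
  ring

end Over

/-! ## §2 The object: the first variation of King's effective Laplacian along a fine-lattice potential, and the generated perturbation tower -/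

section Object

variable (L : ℕ) [NeZero L] (U : Fin (d + 1) → ℕ) [∀ μ, NeZero (U μ)] (a m2 : ℝ)

/-- **THE FIRST VARIATION OF KING'S EFFECTIVE LAPLACIAN ALONG A FINE-LATTICE POTENTIAL.**  With `N` fine points per unit side
(`η = N⁻¹`), King's minimiser kernel `ℋ(x, b)` at the level-`lvl` coefficient `a_{lvl}` (n15-e's `kingH` = `King1986.Torus.minimiser` at `δ_b`,
BY NAME) and a potential `w` on the fine torus `Π ℤ∕(N·U_μ)`, the unit-lattice operator
`E(w)(b, b′) = N^{−(d+1)} Σ_x ℋ(x, b)·w(x)·ℋ(x, b′)` — the derivative at `t = 0` of the block-spin effective quadratic form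
`min_ψ [a‖φ − Qψ‖² + N^{−(d+1)}⟨ψ, (N²(−Δ) + m² + t·w)ψ⟩]` (King's (2.13)–(2.14) energy, tree `King1986.Torus.energy`, with a potential added),
by the envelope formula at the minimiser `ψ_φ = ℋφ` (`King1986.Torus.effLaplacian_eq_energy`).  HONEST SCOPE: a DEFINITION (the envelope identity
and the dressed operator `Δ^{(k)}_{tw}` itself are not constructed here); scalar potential, not a gauge field. [cite: King1986, (2.13)–(2.15) p.653 (the energy and its minimiser ℋ_k = a_kG_kQ_k^*)] -/
def potLevel (N : ℕ) [NeZero N] (lvl : ℕ) (w : Tor (fine N U) → ℝ) : Matrix (Tor U) (Tor U) ℝ :=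
  fun b b' => (((N : ℕ) : ℝ) ^ (d + 1))⁻¹ * ∑ x : Tor (fine N U), kingH L N U a m2 lvl b x * w x * kingH L N U a m2 lvl b' x

/-- **THE PERTURBATION TOWER GENERATED BY A POTENTIAL TOWER** `v = (v_N)_N` (a potential on the fine torus for every fine count `N`): level `j` is
the first variation at `N = L^{max j 1}` fine points per unit side along `v_{L^{max j 1}}` — the ℕ-tower is CONSTANT below level 1, as the
lineage's `kingTower` (King's `a_k` is printed for `k ≥ 1`). [cite: King1986, (2.13) p.653, p.664 (the two runs η = L^{−k}, η′ = L^{−n}η)] -/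
def potTower (v : ∀ N : ℕ, Tor (fine N U) → ℝ) : ℕ → Matrix (Tor U) (Tor U) ℝ :=
  fun j => potLevel L U a m2 (L ^ max j 1) (max j 1) (v (L ^ max j 1))

variable {L U a m2}

omit [NeZero L] in
/-- The first variation depends on the fine count and the level only through their values (transport of the potential along `N = N′`). [folklore] -/
theorem potLevel_congr {N N' : ℕ} [NeZero N] [NeZero N'] (hN : N = N') {lvl lvl' : ℕ} (hl : lvl = lvl')
    (v : ∀ N : ℕ, Tor (fine N U) → ℝ) : potLevel L U a m2 N lvl (v N) = potLevel L U a m2 N' lvl' (v N') := by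
  subst hN; subst hl; rfl

/-- From level 1 on the tower is the first variation at `N = L^j`. [folklore] -/
theorem potTower_of_one_le (v : ∀ N : ℕ, Tor (fine N U) → ℝ) {j : ℕ} (hj : 1 ≤ j) :
    potTower L U a m2 v j = potLevel L U a m2 (L ^ j) j (v (L ^ j)) := by
  have h : max j 1 = j := max_eq_left hj
  show potLevel L U a m2 (L ^ max j 1) (max j 1) (v (L ^ max j 1)) = _
  exact potLevel_congr (by rw [h]) h v

/-- Level 0 of the ℕ-tower is level 1. [folklore] -/
theorem potTower_zero (v : ∀ N : ℕ, Tor (fine N U) → ℝ) : potTower L U a m2 v 0 = potTower L U a m2 v 1 := rfl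

/-- The step `j → j + 1` of the tower for `j ≥ 1`, in King's two-spacing spelling `L^1·L^j` of the finer count. [folklore] -/
theorem potTower_succ_sub (v : ∀ N : ℕ, Tor (fine N U) → ℝ) {j : ℕ} (hj : 1 ≤ j) (b b' : Tor U) :
    (potTower L U a m2 v (j + 1) - potTower L U a m2 v j) b b'
      = potLevel L U a m2 (L ^ 1 * L ^ j) (j + 1) (v (L ^ 1 * L ^ j)) b b' - potLevel L U a m2 (L ^ j) j (v (L ^ j)) b b' := by
  rw [Matrix.sub_apply, potTower_of_one_le v (by omega : 1 ≤ j + 1), potTower_of_one_le v hj,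
    potLevel_congr (N := L ^ (j + 1)) (N' := L ^ 1 * L ^ j) (by ring) rfl v]

/-- At the zero potential tower the perturbation vanishes. [folklore] -/
theorem potTower_zero_potential (j : ℕ) : potTower L U a m2 (fun _ _ => 0) j = 0 := by
  ext b b'
  simp only [potTower, potLevel, mul_zero, zero_mul, sum_const_zero, Matrix.zero_apply]

end Object

/-! ## §3 The entry bounds from the factor bounds (generic in the decay data of the minimiser) -/

section Entry

variable {L : ℕ} [NeZero L] {U : Fin (d + 1) → ℕ} [∀ μ, NeZero (U μ)] {a m2 : ℝ}

omit [NeZero L] in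
/-- **THE TWO-CENTRE BLOCK SUM**: `Σ_z e^{−δ|z−b|}e^{−δ|z−b′|} ≤ K_{d+1}(δ∕2)·e^{−(δ∕2)|b−b′|}` on every unit torus (triangle inequality for half the
decay, `King1986.Torus.tdistT_sumBound` for the other half). [cite: King1986, (4.41) p.675 (the summation mechanism)] -/
theorem sum_exp_two_centre_le {δ : ℝ} (hδ : 0 < δ) (b b' : Tor U) :
    ∑ z : Tor U, Real.exp (-(δ * tdistT U z b)) * Real.exp (-(δ * tdistT U z b'))
      ≤ latticeConst (d + 1) (δ / 2) * Real.exp (-(δ / 2 * tdistT U b b')) := by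
  have hpd := tdistT_isPseudoDist U
  have key : ∀ z, Real.exp (-(δ * tdistT U z b)) * Real.exp (-(δ * tdistT U z b'))
      ≤ Real.exp (-(δ / 2 * tdistT U b b')) * Real.exp (-(δ / 2 * tdistT U b z)) := by
    intro z
    rw [← Real.exp_add, ← Real.exp_add]
    apply Real.exp_le_exp.mpr
    have tri : tdistT U b b' ≤ tdistT U b z + tdistT U z b' := hpd.triangle b z b'
    have hs : tdistT U z b = tdistT U b z := hpd.symm z b
    have h1 := hpd.nonneg b z
    have h2 := hpd.nonneg z b'
    nlinarith
  calc ∑ z : Tor U, Real.exp (-(δ * tdistT U z b)) * Real.exp (-(δ * tdistT U z b'))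
      ≤ ∑ z : Tor U, Real.exp (-(δ / 2 * tdistT U b b')) * Real.exp (-(δ / 2 * tdistT U b z)) := sum_le_sum fun z _ => key z
    _ = Real.exp (-(δ / 2 * tdistT U b b')) * ∑ z : Tor U, Real.exp (-(δ / 2 * tdistT U b z)) := by rw [mul_sum]
    _ ≤ Real.exp (-(δ / 2 * tdistT U b b')) * latticeConst (d + 1) (δ / 2) :=
        mul_le_mul_of_nonneg_left (tdistT_sumBound U (δ / 2) (half_pos hδ) b) (Real.exp_pos _).le
    _ = _ := mul_comm _ _

omit [NeZero L] in
/-- **LOCALITY OF THE FIRST VARIATION, from the minimiser's decay** (pointwise form): if `|ℋ(x, b)| ≤ c·e^{−δ|B(x) − b|}` and `|w| ≤ w₀`, then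
`|E(w)(b, b′)| ≤ w₀c²·K_{d+1}(δ∕2)·e^{−(δ∕2)|b − b′|}` — the first variation along a bounded potential is an exponentially LOCAL unit-lattice operator,
LINEAR in the size of the potential. [cite: King1986, Theorem 3.3 (3.7) p.658 (decay of ℋ_k), (4.41) p.675 (summation)] -/
theorem potLevel_entry_le {N : ℕ} [NeZero N] {lvl : ℕ} {w : Tor (fine N U) → ℝ} {c δ w₀ : ℝ} (hc : 0 ≤ c) (hδ : 0 < δ)
    (hH : ∀ (b : Tor U) (x : Tor (fine N U)), |kingH L N U a m2 lvl b x| ≤ c * Real.exp (-(δ * tdistT U (blockOf N U x) b)))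
    (hw : ∀ x, |w x| ≤ w₀) (b b' : Tor U) :
    |potLevel L U a m2 N lvl w b b'| ≤ w₀ * c ^ 2 * latticeConst (d + 1) (δ / 2) * Real.exp (-(δ / 2 * tdistT U b b')) := by
  have hw0 : 0 ≤ w₀ := (abs_nonneg _).trans (hw (fun μ => 0))
  have hpt : ∀ x : Tor (fine N U), |kingH L N U a m2 lvl b x * w x * kingH L N U a m2 lvl b' x|
      ≤ w₀ * c ^ 2 * (Real.exp (-(δ * tdistT U (blockOf N U x) b)) * Real.exp (-(δ * tdistT U (blockOf N U x) b'))) := by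
    intro x
    rw [abs_mul, abs_mul]
    calc |kingH L N U a m2 lvl b x| * |w x| * |kingH L N U a m2 lvl b' x|
        ≤ (c * Real.exp (-(δ * tdistT U (blockOf N U x) b))) * w₀ * (c * Real.exp (-(δ * tdistT U (blockOf N U x) b'))) :=
          mul_le_mul (mul_le_mul (hH b x) (hw x) (abs_nonneg _) (by positivity)) (hH b' x) (abs_nonneg _) (by positivity)
      _ = _ := by ring
  calc |potLevel L U a m2 N lvl w b b'|
      ≤ ∑ z : Tor U, w₀ * c ^ 2 * (Real.exp (-(δ * tdistT U z b)) * Real.exp (-(δ * tdistT U z b'))) :=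
        abs_avg_sum_le_sum_blocks N U (G := fun z => w₀ * c ^ 2 * (Real.exp (-(δ * tdistT U z b)) * Real.exp (-(δ * tdistT U z b')))) hpt
    _ = w₀ * c ^ 2 * ∑ z : Tor U, Real.exp (-(δ * tdistT U z b)) * Real.exp (-(δ * tdistT U z b')) := by rw [mul_sum]
    _ ≤ w₀ * c ^ 2 * (latticeConst (d + 1) (δ / 2) * Real.exp (-(δ / 2 * tdistT U b b'))) :=
        mul_le_mul_of_nonneg_left (sum_exp_two_centre_le hδ b b') (by positivity)
    _ = _ := by ring

/-- The three-factor telescoping inequality `|f′g′h′ − fgh| ≤ |f′−f||g′||h′| + |f||g′−g||h′| + |f||g||h′−h|`. [folklore] -/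
theorem abs_mul3_sub_mul3_le (f f' g g' h h' : ℝ) :
    |f' * g' * h' - f * g * h| ≤ |f' - f| * |g'| * |h'| + |f| * |g' - g| * |h'| + |f| * |g| * |h' - h| := by
  have e : f' * g' * h' - f * g * h = (f' - f) * g' * h' + f * (g' - g) * h' + f * g * (h' - h) := by ring
  rw [e]
  refine (abs_add_le _ _).trans (add_le_add ((abs_add_le _ _).trans (add_le_add ?_ ?_)) ?_)
  · rw [abs_mul, abs_mul]
  · rw [abs_mul, abs_mul]
  · rw [abs_mul, abs_mul]

/-- **THE TWO-SPACING DIFFERENCE OF THE FIRST VARIATION, from the minimiser's two-spacing rate and the COHERENCE DEFECT of the potentials**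
(pointwise form).  Two runs: `L^k` and `L·L^k` fine points per unit side, minimisers `ℋ`, `ℋ′` with the common decay `|ℋ|, |ℋ′| ≤ c·e^{−δ|B − b|}`
and King's Prop. 3.8 step `|ℋ′(x′, b) − ℋ(x, b)| ≤ C·t·e^{−δ|B(x′) − b|}` (`x` under `x′`, `t` the rate factor), potentials `|w|, |w′| ≤ w₀` with
coherence defect `|w′(x′) − w(x)| ≤ ν`: then `|E′(w′)(b,b′) − E(w)(b,b′)| ≤ (2w₀cCt + c²ν)·K_{d+1}(δ∕2)·e^{−(δ∕2)|b−b′|}` — the fibre identity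
`avg_comp_underPtN` pairs every fine point of the finer run with the point under it. [cite: King1986, Prop. 3.8 (3.71) p.664, p.664 (pairing), (4.41) p.675] -/
theorem potLevel_sub_entry_le {k : ℕ} {w : Tor (fine (L ^ k) U) → ℝ} {w' : Tor (fine (L ^ 1 * L ^ k) U) → ℝ} {c C t δ w₀ ν : ℝ}
    (hc : 0 ≤ c) (hC : 0 ≤ C) (ht : 0 ≤ t) (hδ : 0 < δ)
    (hH : ∀ (b : Tor U) (x : Tor (fine (L ^ k) U)),
      |kingH L (L ^ k) U a m2 k b x| ≤ c * Real.exp (-(δ * tdistT U (blockOf (L ^ k) U x) b)))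
    (hH' : ∀ (b : Tor U) (x' : Tor (fine (L ^ 1 * L ^ k) U)),
      |kingH L (L ^ 1 * L ^ k) U a m2 (k + 1) b x'| ≤ c * Real.exp (-(δ * tdistT U (blockOf (L ^ 1 * L ^ k) U x') b)))
    (hstep : ∀ (b : Tor U) (x' : Tor (fine (L ^ 1 * L ^ k) U)),
      |kingH L (L ^ 1 * L ^ k) U a m2 (k + 1) b x' - kingH L (L ^ k) U a m2 k b (underPtN L k 1 U x')|
        ≤ C * t * Real.exp (-(δ * tdistT U (blockOf (L ^ 1 * L ^ k) U x') b)))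
    (hw : ∀ x, |w x| ≤ w₀) (hw' : ∀ x', |w' x'| ≤ w₀) (hcoh : ∀ x', |w' x' - w (underPtN L k 1 U x')| ≤ ν) (b b' : Tor U) :
    |potLevel L U a m2 (L ^ 1 * L ^ k) (k + 1) w' b b' - potLevel L U a m2 (L ^ k) k w b b'|
      ≤ (2 * w₀ * c * C * t + c ^ 2 * ν) * latticeConst (d + 1) (δ / 2) * Real.exp (-(δ / 2 * tdistT U b b')) := by
  have hw0 : 0 ≤ w₀ := (abs_nonneg _).trans (hw (fun μ => 0))
  have hν0 : 0 ≤ ν := (abs_nonneg _).trans (hcoh (fun μ => 0))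
  -- pair every point of the finer run with the point under it
  have hdiff : potLevel L U a m2 (L ^ 1 * L ^ k) (k + 1) w' b b' - potLevel L U a m2 (L ^ k) k w b b'
      = (((L ^ 1 * L ^ k : ℕ) : ℝ) ^ (d + 1))⁻¹ * ∑ x' : Tor (fine (L ^ 1 * L ^ k) U),
          (kingH L (L ^ 1 * L ^ k) U a m2 (k + 1) b x' * w' x' * kingH L (L ^ 1 * L ^ k) U a m2 (k + 1) b' x'
            - kingH L (L ^ k) U a m2 k b (underPtN L k 1 U x') * w (underPtN L k 1 U x')
                * kingH L (L ^ k) U a m2 k b' (underPtN L k 1 U x')) := by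
    unfold potLevel
    rw [← avg_comp_underPtN L U k (fun x => kingH L (L ^ k) U a m2 k b x * w x * kingH L (L ^ k) U a m2 k b' x), ← mul_sub,
      ← sum_sub_distrib]
  rw [hdiff]
  -- pointwise bound at every fine point of the finer run, in terms of its unit block
  have hpt : ∀ x' : Tor (fine (L ^ 1 * L ^ k) U),
      |kingH L (L ^ 1 * L ^ k) U a m2 (k + 1) b x' * w' x' * kingH L (L ^ 1 * L ^ k) U a m2 (k + 1) b' x'
          - kingH L (L ^ k) U a m2 k b (underPtN L k 1 U x') * w (underPtN L k 1 U x')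
              * kingH L (L ^ k) U a m2 k b' (underPtN L k 1 U x')|
        ≤ (2 * w₀ * c * C * t + c ^ 2 * ν) * (Real.exp (-(δ * tdistT U (blockOf (L ^ 1 * L ^ k) U x') b))
            * Real.exp (-(δ * tdistT U (blockOf (L ^ 1 * L ^ k) U x') b'))) := by
    intro x'
    set eb := Real.exp (-(δ * tdistT U (blockOf (L ^ 1 * L ^ k) U x') b)) with heb
    set eb' := Real.exp (-(δ * tdistT U (blockOf (L ^ 1 * L ^ k) U x') b')) with heb'
    have h1 : |kingH L (L ^ 1 * L ^ k) U a m2 (k + 1) b x' - kingH L (L ^ k) U a m2 k b (underPtN L k 1 U x')| ≤ C * t * eb :=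
      hstep b x'
    have h3 : |kingH L (L ^ 1 * L ^ k) U a m2 (k + 1) b' x' - kingH L (L ^ k) U a m2 k b' (underPtN L k 1 U x')| ≤ C * t * eb' :=
      hstep b' x'
    have hf : |kingH L (L ^ k) U a m2 k b (underPtN L k 1 U x')| ≤ c * eb := by
      have h := hH b (underPtN L k 1 U x'); rwa [blockOf_underPtN] at h
    have hh' : |kingH L (L ^ 1 * L ^ k) U a m2 (k + 1) b' x'| ≤ c * eb' := hH' b' x'
    have hg : |w (underPtN L k 1 U x')| ≤ w₀ := hw _
    have hg' : |w' x'| ≤ w₀ := hw' x'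
    have h2 : |w' x' - w (underPtN L k 1 U x')| ≤ ν := hcoh x'
    have heb0 : 0 ≤ eb := (Real.exp_pos _).le
    have heb0' : 0 ≤ eb' := (Real.exp_pos _).le
    calc _ ≤ |kingH L (L ^ 1 * L ^ k) U a m2 (k + 1) b x' - kingH L (L ^ k) U a m2 k b (underPtN L k 1 U x')| * |w' x'|
              * |kingH L (L ^ 1 * L ^ k) U a m2 (k + 1) b' x'|
            + |kingH L (L ^ k) U a m2 k b (underPtN L k 1 U x')| * |w' x' - w (underPtN L k 1 U x')|
              * |kingH L (L ^ 1 * L ^ k) U a m2 (k + 1) b' x'|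
            + |kingH L (L ^ k) U a m2 k b (underPtN L k 1 U x')| * |w (underPtN L k 1 U x')|
              * |kingH L (L ^ 1 * L ^ k) U a m2 (k + 1) b' x' - kingH L (L ^ k) U a m2 k b' (underPtN L k 1 U x')| :=
          abs_mul3_sub_mul3_le _ _ _ _ _ _
      _ ≤ (C * t * eb) * w₀ * (c * eb') + (c * eb) * ν * (c * eb') + (c * eb) * w₀ * (C * t * eb') := by
          refine add_le_add (add_le_add ?_ ?_) ?_
          · exact mul_le_mul (mul_le_mul h1 hg' (abs_nonneg _) (by positivity)) hh' (abs_nonneg _) (by positivity)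
          · exact mul_le_mul (mul_le_mul hf h2 (abs_nonneg _) (by positivity)) hh' (abs_nonneg _) (by positivity)
          · exact mul_le_mul (mul_le_mul hf hg (abs_nonneg _) (by positivity)) h3 (abs_nonneg _) (by positivity)
      _ = (2 * w₀ * c * C * t + c ^ 2 * ν) * (eb * eb') := by ring
  calc _ ≤ ∑ z : Tor U, (2 * w₀ * c * C * t + c ^ 2 * ν) * (Real.exp (-(δ * tdistT U z b)) * Real.exp (-(δ * tdistT U z b'))) :=
        abs_avg_sum_le_sum_blocks (L ^ 1 * L ^ k) U
          (G := fun z => (2 * w₀ * c * C * t + c ^ 2 * ν) * (Real.exp (-(δ * tdistT U z b)) * Real.exp (-(δ * tdistT U z b')))) hpt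
    _ = (2 * w₀ * c * C * t + c ^ 2 * ν) * ∑ z : Tor U, Real.exp (-(δ * tdistT U z b)) * Real.exp (-(δ * tdistT U z b')) := by
        rw [mul_sum]
    _ ≤ (2 * w₀ * c * C * t + c ^ 2 * ν) * (latticeConst (d + 1) (δ / 2) * Real.exp (-(δ / 2 * tdistT U b b'))) :=
        mul_le_mul_of_nonneg_left (sum_exp_two_centre_le hδ b b') (by positivity)
    _ = _ := by ring

end Entry

/-! ## §4 The King-admissible unit tori (the volumes of parts 8b–8c) -/

/-- THE BLOCK NUMBERS OF THE KING-ADMISSIBLE UNIT TORI in dimension `dd + 1`: `2L^e` blocks of side `L` per direction (volume exponent `e`).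
[cite: Balaban1987RG1, (0.1) p.251] -/
abbrev kingM (dd L e : ℕ) : Fin (dd + 1) → ℕ := fun _ => 2 * L ^ e

/-- THE KING-ADMISSIBLE UNIT TORUS `Π_μ ℤ∕(2L^{e+1})`, spelled `fine L (kingM dd L e)`: the carrier of the lineage's `kingTower`∕`kingCov` (on `fine L M`)
AND a volume of Bałaban's parameter records (`sitesPerDir`), on which King's minimiser theorems are stated. [cite: Balaban1987RG1, (0.1) p.251] -/
abbrev kingU (dd L e : ℕ) : Fin (dd + 1) → ℕ := fine L (kingM dd L e)

end Summit.QuantumFields.YangMills.BalabanUVNodes.N15.KingModel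

end
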